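import Summits.NavierStokesRegularity.NavierStokesRegularity.Theses.HodographBetchov
import Summits.NavierStokesRegularity.NavierStokesRegularity.Theorems.HodographBetchovSlowClassProductionStubSlabProduction
import Literature.Analysis.FluidPDE.TaoLocalisationHolds
import Literature.Analysis.FluidPDE.NSVorticityBKMContinuation
import Literature.Analysis.FluidPDE.TaoEnstrophyLocalisation

/-!
# `SlowClassProduction` (stmt-NavierStokesRegularity-15831) lives at the lifespan

Route `HodographBetchov`, crux 2 `SlowClassProduction`: for `ν, T > 0`, a classical solution `(u,p)`
of unforced Navier–Stokes on `ℝ³ × [0,T)` that is Leray–Hopf from its rapidly decaying datum, and a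
speed level `l > 0`, the enstrophy production `P = ⟪ω, ∇u ω⟫` has `∫_{S_t} P ≤ C` uniformly in
`t < T`, where `S_t = {(s,x) : 0 < s < t, |u(s,x)| ≤ l}` is the slow space-time class.

This file records, sorry-free, the exact REDUCTIONS of the crux that the tree's local theory affords
(helpers `--supports stmt-NavierStokesRegularity-15831`; none of them is the crux):
`slowClassBudget_of_integrableOn` (budget from `P ∈ L¹((0,T) × ℝ³)`),
`integrableOn_production_closedSlab` (classical finite-energy solutions on a CLOSED slab have
`P ∈ L¹`; Tao 2013, Cor. 11.1), `slowClassBudget_of_hasSmoothExtensionPast` (the budget holds at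
every level whenever `u` extends smoothly past `T`: Fatou at `t = T` + Tao's persistence for the
extension), `slowClassBudget_below` (the budget on every `[0,T₀)`, `T₀ < T`),
`isMaximalSmoothSolution_of_unbounded_slowClassBudget` (blow-up criterion shape) and
`slowClassProduction_iff_maximal`: the crux is EQUIVALENT to its restriction to maximal smooth
solutions — its whole content is an a-priori bound at the blow-up time (the COLLAR stub of the
registered skeleton `Cruxes/SlowClassProduction/Lines/birth.lean`).
-/

noncomputable section

-- the summit and its single problem share the name `NavierStokesRegularity` (D-0017 nested layout)
set_option linter.dupNamespace false

namespace Summit.NavierStokesRegularity.NavierStokesRegularity.Theorems.SlowClassProduction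

open Set MeasureTheory Function Filter Topology Literature.Analysis.FluidPDE
open scoped ENNReal NNReal ContDiff RealInnerProductSpace

/-! ## Measure theory: the budget from slab integrability -/

/-- **Slow-class budget from slab integrability.**  If the production `P` is integrable on the open
slab `(0,T) × ℝ³`, then at every level `l` the slow class `S_t = {0 < s < t, |u(s,x)| ≤ l}`,
`t < T`, carries `P` integrably with `∫_{S_t} P ≤ ∫_{S_t} |P| ≤ ∫∫_{(0,T)×ℝ³} |P| =: C`. -/
theorem slowClassBudget_of_integrableOn
    {u : ℝ → EuclideanSpace ℝ (Fin 3) → EuclideanSpace ℝ (Fin 3)} {T : ℝ} (l : ℝ)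
    (hI : MeasureTheory.IntegrableOn
      (fun z : ℝ × EuclideanSpace ℝ (Fin 3) =>
        inner ℝ (Literature.Analysis.FluidPDE.curl (u z.1) z.2)
          (fderiv ℝ (u z.1) z.2 (Literature.Analysis.FluidPDE.curl (u z.1) z.2)))
      (Set.Ioo 0 T ×ˢ (Set.univ : Set (EuclideanSpace ℝ (Fin 3))))) :
    ∃ C : ℝ, ∀ t ∈ Set.Ico 0 T,
      MeasureTheory.IntegrableOn
        (fun z : ℝ × EuclideanSpace ℝ (Fin 3) =>
          inner ℝ (Literature.Analysis.FluidPDE.curl (u z.1) z.2)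
            (fderiv ℝ (u z.1) z.2 (Literature.Analysis.FluidPDE.curl (u z.1) z.2)))
        {z : ℝ × EuclideanSpace ℝ (Fin 3) | z.1 ∈ Set.Ioo 0 t ∧ ‖u z.1 z.2‖ ≤ l} ∧
      ∫ z in {z : ℝ × EuclideanSpace ℝ (Fin 3) | z.1 ∈ Set.Ioo 0 t ∧ ‖u z.1 z.2‖ ≤ l},
        inner ℝ (Literature.Analysis.FluidPDE.curl (u z.1) z.2)
          (fderiv ℝ (u z.1) z.2 (Literature.Analysis.FluidPDE.curl (u z.1) z.2)) ≤ C := by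
  set P : ℝ × EuclideanSpace ℝ (Fin 3) → ℝ :=
    fun z => inner ℝ (curl (u z.1) z.2) (fderiv ℝ (u z.1) z.2 (curl (u z.1) z.2)) with hP_def
  refine ⟨∫ z in Set.Ioo 0 T ×ˢ (Set.univ : Set (EuclideanSpace ℝ (Fin 3))), |P z|, ?_⟩
  intro t ht
  have hsub : {z : ℝ × EuclideanSpace ℝ (Fin 3) | z.1 ∈ Set.Ioo 0 t ∧ ‖u z.1 z.2‖ ≤ l} ⊆
      Set.Ioo 0 T ×ˢ (Set.univ : Set (EuclideanSpace ℝ (Fin 3))) := by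
    rintro z ⟨hz, -⟩
    exact Set.mk_mem_prod ⟨hz.1, hz.2.trans ht.2⟩ (Set.mem_univ _)
  have hIt : IntegrableOn P {z : ℝ × EuclideanSpace ℝ (Fin 3) | z.1 ∈ Set.Ioo 0 t ∧ ‖u z.1 z.2‖ ≤ l} :=
    hI.mono_set hsub
  refine ⟨hIt, ?_⟩
  calc ∫ z in {z : ℝ × EuclideanSpace ℝ (Fin 3) | z.1 ∈ Set.Ioo 0 t ∧ ‖u z.1 z.2‖ ≤ l}, P z
      ≤ ∫ z in {z : ℝ × EuclideanSpace ℝ (Fin 3) | z.1 ∈ Set.Ioo 0 t ∧ ‖u z.1 z.2‖ ≤ l}, |P z| :=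
        integral_mono hIt hIt.abs fun z => le_abs_self _
    _ ≤ ∫ z in Set.Ioo 0 T ×ˢ (Set.univ : Set (EuclideanSpace ℝ (Fin 3))), |P z| :=
        setIntegral_mono_set hI.abs (ae_of_all _ fun z => abs_nonneg _) hsub.eventuallyLE

/-! ## Production is `L¹` on closed slabs of classical finite-energy solutions -/

/-- **Production is integrable on a closed slab.**  For `ν > 0`, `t₁ > 0` and a classical solution
`(u,p)` of unforced Navier–Stokes on the CLOSED slab `[0,t₁] × ℝ³` with energy bounded on `[0,t₁]`
and rapidly decaying datum `u 0`, the production `P` is integrable on `(0,t₁) × ℝ³`: Tao's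
persistence of regularity (Tao 2013, Cor. 11.1 + Cor. 4.3 + Thm. 5.4 (iv); tree theorem
`tao2011_hasBoundedSobolevNormsOn_holds`) and the Sobolev imbedding give `‖∇u‖ ≤ B` on the slab, so
`|P| ≤ κ² B ‖∇u‖²` (`κ = ‖curlCLM‖`) with `∫ ‖∇u(t)‖² ≤ C₁`; domination + Tonelli.  (The argument of
the landed `Birth.stub_slabProduction` with the closed-slab hypotheses made explicit, so that it
applies to smooth EXTENSIONS.) [cite: Tao2011, Cor. 11.1 + Cor. 4.3 + Thm. 5.4 (iv)] -/
theorem integrableOn_production_closedSlab {ν t₁ : ℝ} (hν : 0 < ν) (ht₁ : 0 < t₁)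
    {u : ℝ → EuclideanSpace ℝ (Fin 3) → EuclideanSpace ℝ (Fin 3)}
    {p : ℝ → EuclideanSpace ℝ (Fin 3) → ℝ}
    (hsol : Literature.Analysis.FluidPDE.IsClassicalNSSolutionOn (Set.Icc 0 t₁) ν 0 u p)
    (hE : ∃ C : ℝ≥0, ∀ t ∈ Set.Icc 0 t₁, ∫⁻ x, ‖u t x‖ₑ ^ 2 ≤ C)
    (hdec : Literature.Analysis.FluidPDE.HasRapidSpatialDecay (u 0)) :
    MeasureTheory.IntegrableOn
      (fun z : ℝ × EuclideanSpace ℝ (Fin 3) =>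
        inner ℝ (Literature.Analysis.FluidPDE.curl (u z.1) z.2)
          (fderiv ℝ (u z.1) z.2 (Literature.Analysis.FluidPDE.curl (u z.1) z.2)))
      (Set.Ioo 0 t₁ ×ˢ (Set.univ : Set (EuclideanSpace ℝ (Fin 3)))) := by
  -- adapted from Theorems/HodographBetchovSlowClassProductionStubSlabProduction.lean
  have hUD : UniqueDiffOn ℝ (Icc 0 t₁) := uniqueDiffOn_Icc ht₁
  have hH : HasBoundedSobolevNormsOn (Icc 0 t₁) u :=
    tao2011_hasBoundedSobolevNormsOn_holds hν ht₁ hsol hE hdec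
  have hC3 : ∀ t ∈ Icc 0 t₁, ContDiff ℝ 3 (u t) := fun t ht =>
    (hsol.contDiff_velocity ht).of_le (by norm_cast)
  obtain ⟨B, hB0, hB⟩ := exists_forall_norm_fderiv_le_of_hasBoundedSobolevNormsOn hC3 hH
  obtain ⟨C₁, hC₁⟩ := hH 1
  set D : ℝ × EuclideanSpace ℝ (Fin 3) → EuclideanSpace ℝ (Fin 3) →L[ℝ] EuclideanSpace ℝ (Fin 3) :=
    fun z => fderiv ℝ (u z.1) z.2 with hD_def
  set κ : ℝ := ‖curlCLM‖ with hκ_def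
  set P : ℝ × EuclideanSpace ℝ (Fin 3) → ℝ :=
    fun z => inner ℝ (curl (u z.1) z.2) (fderiv ℝ (u z.1) z.2 (curl (u z.1) z.2)) with hP_def
  set g : ℝ × EuclideanSpace ℝ (Fin 3) → ℝ := fun z => κ ^ 2 * B * ‖D z‖ ^ 2 with hg_def
  change IntegrableOn P (Ioo 0 t₁ ×ˢ univ)
  -- ### pointwise domination `|P| ≤ κ² B ‖∇u‖²` on the slab
  have hP_le : ∀ z : ℝ × EuclideanSpace ℝ (Fin 3), z.1 ∈ Icc 0 t₁ → ‖P z‖ ≤ g z := by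
    intro z hz
    have hω : ‖curl (u z.1) z.2‖ ≤ κ * ‖D z‖ := norm_curl_le _ _
    have hDz : ‖D z‖ ≤ B := hB z.1 hz z.2
    calc ‖P z‖ ≤ ‖curl (u z.1) z.2‖ * ‖D z (curl (u z.1) z.2)‖ := norm_inner_le_norm _ _
      _ ≤ ‖curl (u z.1) z.2‖ * (‖D z‖ * ‖curl (u z.1) z.2‖) := by
          gcongr
          exact (D z).le_opNorm _
      _ = ‖D z‖ * ‖curl (u z.1) z.2‖ ^ 2 := by ring
      _ ≤ B * (κ * ‖D z‖) ^ 2 := by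
          gcongr
      _ = g z := by rw [hg_def]; ring
  -- ### joint continuity of `∇u`, of `P` and of the majorant on `[0,t₁] × ℝ³`
  have hDcont : ContinuousOn D (Icc 0 t₁ ×ˢ univ) :=
    (hsol.smooth_velocity.fderiv_slice hUD).continuousOn
  have hωcont : ContinuousOn (fun z : ℝ × EuclideanSpace ℝ (Fin 3) => curl (u z.1) z.2)
      (Icc 0 t₁ ×ˢ univ) :=
    curlCLM.continuous.comp_continuousOn hDcont
  have hPcont : ContinuousOn P (Icc 0 t₁ ×ˢ univ) :=
    hωcont.inner (hDcont.clm_apply hωcont)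
  have hgcont : ContinuousOn g (Icc 0 t₁ ×ˢ univ) :=
    continuousOn_const.mul (hDcont.norm.pow 2)
  have hmeasS : MeasurableSet (Ioo (0 : ℝ) t₁ ×ˢ (univ : Set (EuclideanSpace ℝ (Fin 3)))) :=
    measurableSet_Ioo.prod MeasurableSet.univ
  have hsub : Ioo (0 : ℝ) t₁ ×ˢ (univ : Set (EuclideanSpace ℝ (Fin 3))) ⊆ Icc 0 t₁ ×ˢ univ :=
    prod_mono Ioo_subset_Icc_self Subset.rfl
  have hPm : AEStronglyMeasurable P (volume.restrict (Ioo (0 : ℝ) t₁ ×ˢ univ)) :=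
    (hPcont.mono hsub).aestronglyMeasurable hmeasS
  have hgm : AEStronglyMeasurable g (volume.restrict (Ioo (0 : ℝ) t₁ ×ˢ univ)) :=
    (hgcont.mono hsub).aestronglyMeasurable hmeasS
  -- ### the majorant is integrable on the slab (Tonelli + the `k = 1` Sobolev bound)
  have hslice : ∀ t ∈ Icc 0 t₁,
      ∫⁻ x, ‖g (t, x)‖ₑ ≤ ENNReal.ofReal (κ ^ 2 * B) * C₁ := by
    intro t ht
    have hc0 : 0 ≤ κ ^ 2 * B := by positivity
    have hgx : ∀ x, ‖g (t, x)‖ₑ = ENNReal.ofReal (κ ^ 2 * B) * ‖iteratedFDeriv ℝ 1 (u t) x‖ₑ ^ 2 := by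
      intro x
      have hg0 : 0 ≤ g (t, x) := by rw [hg_def]; positivity
      rw [Real.enorm_eq_ofReal hg0, hg_def]
      change ENNReal.ofReal (κ ^ 2 * B * ‖fderiv ℝ (u t) x‖ ^ 2) = _
      rw [ENNReal.ofReal_mul hc0, ← norm_iteratedFDeriv_one (𝕜 := ℝ) (u t),
        ENNReal.ofReal_pow (norm_nonneg _), ofReal_norm]
    calc ∫⁻ x, ‖g (t, x)‖ₑ
        = ∫⁻ x, ENNReal.ofReal (κ ^ 2 * B) * ‖iteratedFDeriv ℝ 1 (u t) x‖ₑ ^ 2 :=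
          lintegral_congr hgx
      _ = ENNReal.ofReal (κ ^ 2 * B) * ∫⁻ x, ‖iteratedFDeriv ℝ 1 (u t) x‖ₑ ^ 2 := by
          rw [lintegral_const_mul' _ _ ENNReal.ofReal_ne_top]
      _ ≤ ENNReal.ofReal (κ ^ 2 * B) * C₁ := by
          gcongr
          exact hC₁ t ht
  have hg_fin : ∫⁻ z in Ioo (0 : ℝ) t₁ ×ˢ (univ : Set (EuclideanSpace ℝ (Fin 3))), ‖g z‖ₑ < ⊤ := by
    have hμ : (volume.restrict (Ioo (0 : ℝ) t₁ ×ˢ (univ : Set (EuclideanSpace ℝ (Fin 3)))) :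
        Measure (ℝ × EuclideanSpace ℝ (Fin 3))) =
        (volume.restrict (Ioo (0 : ℝ) t₁)).prod
          ((volume : Measure (EuclideanSpace ℝ (Fin 3))).restrict univ) := by
      rw [Measure.prod_restrict, ← Measure.volume_eq_prod]
    rw [hμ]
    calc ∫⁻ z, ‖g z‖ₑ ∂(volume.restrict (Ioo (0 : ℝ) t₁)).prod
            ((volume : Measure (EuclideanSpace ℝ (Fin 3))).restrict univ)
        ≤ ∫⁻ t in Ioo (0 : ℝ) t₁, ∫⁻ x in univ, ‖g (t, x)‖ₑ := lintegral_prod_le _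
      _ ≤ ∫⁻ _ in Ioo (0 : ℝ) t₁, ENNReal.ofReal (κ ^ 2 * B) * C₁ := by
          refine setLIntegral_mono' measurableSet_Ioo fun t ht => ?_
          rw [Measure.restrict_univ]
          exact hslice t (Ioo_subset_Icc_self ht)
      _ = ENNReal.ofReal (κ ^ 2 * B) * C₁ * volume (Ioo (0 : ℝ) t₁) := setLIntegral_const _ _
      _ < ⊤ := by
          refine ENNReal.mul_lt_top (ENNReal.mul_lt_top ENNReal.ofReal_lt_top ENNReal.coe_lt_top) ?_
          rw [Real.volume_Ioo]
          exact ENNReal.ofReal_lt_top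
  have hg_int : Integrable g (volume.restrict (Ioo (0 : ℝ) t₁ ×ˢ (univ : Set (EuclideanSpace ℝ (Fin 3))))) :=
    ⟨hgm, hg_fin⟩
  -- ### domination
  refine Integrable.mono' hg_int hPm ?_
  filter_upwards [ae_restrict_mem hmeasS] with z hz
  exact hP_le z (Ioo_subset_Icc_self hz.1)

/-! ## The budget holds whenever the solution extends smoothly past `T` -/

/-- **Fatou at the lifespan.**  If `u` is Leray–Hopf on `[0,T)` from `u 0` (unforced, `ν ≥ 0`) and
`u'` is a field, jointly continuous on `[0,T] × ℝ³`, that agrees with `u` on `[0,T)`, then the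
energy of `u'` is bounded by the initial energy on the CLOSED interval `[0,T]`: for `t < T` this is
the Leray–Hopf energy inequality, and at `t = T` Fatou's lemma along `tₙ ↑ T` (pointwise convergence
`u tₙ x = u' tₙ x → u' T x` by continuity in time). [cite: Leray1934, (5.2)] -/
theorem lintegral_enorm_sq_extension_le {ν T : ℝ} (hν : 0 ≤ ν) (hT : 0 < T)
    {u u' : ℝ → EuclideanSpace ℝ (Fin 3) → EuclideanSpace ℝ (Fin 3)}
    (hLH : Literature.Analysis.FluidPDE.IsLerayHopfOn T ν 0 (u 0) u)
    (hcont : ContinuousOn (Function.uncurry u')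
      (Set.Icc 0 T ×ˢ (Set.univ : Set (EuclideanSpace ℝ (Fin 3)))))
    (hagree : ∀ t ∈ Set.Ico 0 T, u' t = u t) :
    ∀ t ∈ Set.Icc 0 T, ∫⁻ x, ‖u' t x‖ₑ ^ 2 ≤
      ENNReal.ofReal (2 * VectorCalculus.kineticEnergy (u 0)) := by
  intro t ht
  rcases ht.2.lt_or_eq with htT | rfl
  · rw [hagree t ⟨ht.1, htT⟩]
    exact hLH.lintegral_enorm_sq_le hν ht
  · -- `t = T`: Fatou along `tₙ = max 0 (T - 1/(n+1)) ↑ T`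
    set c : ℝ≥0∞ := ENNReal.ofReal (2 * VectorCalculus.kineticEnergy (u 0)) with hc_def
    set s : ℕ → ℝ := fun n => max 0 (t - 1 / ((n : ℝ) + 1)) with hs_def
    have hs_mem : ∀ n, s n ∈ Set.Ico 0 t := by
      intro n
      refine ⟨le_max_left _ _, max_lt hT ?_⟩
      have : (0 : ℝ) < 1 / ((n : ℝ) + 1) := by positivity
      linarith
    have hs_tend : Tendsto s atTop (𝓝 t) := by
      have h1 : Tendsto (fun n : ℕ => t - 1 / ((n : ℝ) + 1)) atTop (𝓝 (t - 0)) :=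
        tendsto_const_nhds.sub tendsto_one_div_add_atTop_nhds_zero_nat
      rw [sub_zero] at h1
      have h2 := (tendsto_const_nhds (x := (0 : ℝ))).max h1
      rwa [max_eq_right ht.1] at h2
    -- pointwise convergence of the slices along `s n`
    have hpt : ∀ x, Tendsto (fun n => ‖u (s n) x‖ₑ ^ 2) atTop (𝓝 (‖u' t x‖ₑ ^ 2)) := by
      intro x
      have hcw : ContinuousWithinAt (fun τ : ℝ => u' τ x) (Set.Icc 0 t) t := by
        have hc1 : ContinuousWithinAt (Function.uncurry u') (Set.Icc 0 t ×ˢ Set.univ) (t, x) :=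
          hcont (t, x) (Set.mk_mem_prod ht (Set.mem_univ x))
        have hc2 : ContinuousWithinAt (fun τ : ℝ => ((τ, x) : ℝ × EuclideanSpace ℝ (Fin 3)))
            (Set.Icc 0 t) t :=
          (continuous_id.prodMk continuous_const).continuousWithinAt
        exact ContinuousWithinAt.comp
          (f := fun τ : ℝ => ((τ, x) : ℝ × EuclideanSpace ℝ (Fin 3))) (x := t) hc1 hc2
          (fun τ hτ => Set.mk_mem_prod hτ (Set.mem_univ x))
      have hst : Tendsto s atTop (𝓝[Set.Icc 0 t] t) :=
        tendsto_nhdsWithin_of_tendsto_nhds_of_eventually_within _ hs_tend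
          (Eventually.of_forall fun n => Ico_subset_Icc_self (hs_mem n))
      have h3 : Tendsto (fun n => u' (s n) x) atTop (𝓝 (u' t x)) := hcw.tendsto.comp hst
      have h4 : Tendsto (fun n => u (s n) x) atTop (𝓝 (u' t x)) := by
        refine h3.congr fun n => ?_
        rw [hagree (s n) (hs_mem n)]
      exact ((ENNReal.continuous_pow 2).tendsto _).comp h4.enorm
    have hmeas : ∀ n, AEMeasurable (fun x => ‖u (s n) x‖ₑ ^ 2)
        (volume : Measure (EuclideanSpace ℝ (Fin 3))) := by
      intro n
      have hm : AEStronglyMeasurable (u (s n)) (volume : Measure (EuclideanSpace ℝ (Fin 3))) :=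
        (hLH.memLp (s n) (Ico_subset_Icc_self (hs_mem n))).aestronglyMeasurable
      exact (hm.enorm.pow_const 2)
    calc ∫⁻ x, ‖u' t x‖ₑ ^ 2
        = ∫⁻ x, liminf (fun n => ‖u (s n) x‖ₑ ^ 2) atTop := by
          refine lintegral_congr fun x => ?_
          rw [(hpt x).liminf_eq]
      _ ≤ liminf (fun n => ∫⁻ x, ‖u (s n) x‖ₑ ^ 2) atTop := lintegral_liminf_le' hmeas
      _ ≤ c := by
          refine liminf_le_of_frequently_le' (Eventually.of_forall fun n => ?_).frequently
          exact hLH.lintegral_enorm_sq_le hν (Ico_subset_Icc_self (hs_mem n))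

/-- **Production is `L¹((0,T) × ℝ³)` whenever the solution extends smoothly past `T`.**  For
`ν, T > 0`, a velocity field `u` that is Leray–Hopf on `[0,T)` from its rapidly decaying datum
`u 0`, and which extends smoothly past `T` (`HasSmoothExtensionPast ν 0 u T`: a classical solution
`(u',p')` on some `[0,T')`, `T' > T`, with `u' = u` on `[0,T)`), the production of `u` is integrable
on `(0,T) × ℝ³`.  Proof: `u'` is classical on the closed slab `[0,T]`, has energy bounded there
(`lintegral_enorm_sq_extension_le`) and datum `u' 0 = u 0`; apply
`integrableOn_production_closedSlab` to `u'` and transfer along `u' = u` on `(0,T) × ℝ³`.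
[cite: Tao2011, Cor. 11.1 + Cor. 4.3 + Thm. 5.4 (iv)] -/
theorem integrableOn_production_of_hasSmoothExtensionPast {ν T : ℝ} (hν : 0 < ν) (hT : 0 < T)
    {u : ℝ → EuclideanSpace ℝ (Fin 3) → EuclideanSpace ℝ (Fin 3)}
    (hLH : Literature.Analysis.FluidPDE.IsLerayHopfOn T ν 0 (u 0) u)
    (hdec : Literature.Analysis.FluidPDE.HasRapidSpatialDecay (u 0))
    (hext : Literature.Analysis.FluidPDE.HasSmoothExtensionPast ν 0 u T) :
    MeasureTheory.IntegrableOn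
      (fun z : ℝ × EuclideanSpace ℝ (Fin 3) =>
        inner ℝ (Literature.Analysis.FluidPDE.curl (u z.1) z.2)
          (fderiv ℝ (u z.1) z.2 (Literature.Analysis.FluidPDE.curl (u z.1) z.2)))
      (Set.Ioo 0 T ×ˢ (Set.univ : Set (EuclideanSpace ℝ (Fin 3)))) := by
  obtain ⟨T', hTT', u', p', hcl', hagree⟩ := hext
  have hT' : 0 < T' := hT.trans hTT'
  have hsol' : IsClassicalNSSolutionOn (Icc 0 T) ν 0 u' p' :=
    hcl'.mono (Icc_subset_Ico_right hTT') (uniqueDiffOn_Icc hT)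
  have hcont : ContinuousOn (Function.uncurry u')
      (Set.Icc 0 T ×ˢ (Set.univ : Set (EuclideanSpace ℝ (Fin 3)))) :=
    hsol'.smooth_velocity.continuousOn
  have hE' : ∃ C : ℝ≥0, ∀ t ∈ Set.Icc 0 T, ∫⁻ x, ‖u' t x‖ₑ ^ 2 ≤ C :=
    ⟨(2 * VectorCalculus.kineticEnergy (u 0)).toNNReal,
      lintegral_enorm_sq_extension_le hν.le hT hLH hcont hagree⟩
  have h0 : u' 0 = u 0 := hagree 0 ⟨le_rfl, hT⟩
  have hdec' : HasRapidSpatialDecay (u' 0) := h0 ▸ hdec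
  have hI' := integrableOn_production_closedSlab hν hT hsol' hE' hdec'
  refine hI'.congr_fun ?_ (measurableSet_Ioo.prod MeasurableSet.univ)
  rintro ⟨s, x⟩ ⟨hs, -⟩
  have hsx : u' s = u s := hagree s ⟨hs.1.le, hs.2⟩
  simp only [hsx]

/-- **The slow-class budget holds at every level whenever the solution extends smoothly past `T`.**
For `ν, T > 0` and a velocity field `u`, Leray–Hopf on `[0,T)` from its rapidly decaying datum and
extending smoothly past `T`, and every level `l > 0`, there is `C` with the production integrable on
the slow class `S_t` and `∫_{S_t} P ≤ C` for all `t ∈ [0,T)` — the conclusion of the crux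
`SlowClassProduction` for this `(u, T, l)`.  Hence the crux has content only at `T` = the lifespan
of `u` (`slowClassProduction_iff_maximal`). [cite: Tao2011, Cor. 11.1 + Cor. 4.3 + Thm. 5.4 (iv)] -/
theorem slowClassBudget_of_hasSmoothExtensionPast {ν T : ℝ} (hν : 0 < ν) (hT : 0 < T)
    {u : ℝ → EuclideanSpace ℝ (Fin 3) → EuclideanSpace ℝ (Fin 3)}
    (hLH : Literature.Analysis.FluidPDE.IsLerayHopfOn T ν 0 (u 0) u)
    (hdec : Literature.Analysis.FluidPDE.HasRapidSpatialDecay (u 0))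
    (hext : Literature.Analysis.FluidPDE.HasSmoothExtensionPast ν 0 u T) :
    ∀ l : ℝ, 0 < l → ∃ C : ℝ, ∀ t ∈ Set.Ico 0 T,
      MeasureTheory.IntegrableOn
        (fun z : ℝ × EuclideanSpace ℝ (Fin 3) =>
          inner ℝ (Literature.Analysis.FluidPDE.curl (u z.1) z.2)
            (fderiv ℝ (u z.1) z.2 (Literature.Analysis.FluidPDE.curl (u z.1) z.2)))
        {z : ℝ × EuclideanSpace ℝ (Fin 3) | z.1 ∈ Set.Ioo 0 t ∧ ‖u z.1 z.2‖ ≤ l} ∧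
      ∫ z in {z : ℝ × EuclideanSpace ℝ (Fin 3) | z.1 ∈ Set.Ioo 0 t ∧ ‖u z.1 z.2‖ ≤ l},
        inner ℝ (Literature.Analysis.FluidPDE.curl (u z.1) z.2)
          (fderiv ℝ (u z.1) z.2 (Literature.Analysis.FluidPDE.curl (u z.1) z.2)) ≤ C :=
  fun l _ => slowClassBudget_of_integrableOn l
    (integrableOn_production_of_hasSmoothExtensionPast hν hT hLH hdec hext)

/-- **The budget strictly before `T`.**  Under the hypotheses of the crux (classical on `[0,T)`,
Leray–Hopf on `[0,T)` from a rapidly decaying datum), for every `T₀ < T` and every level `l` the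
slow-class budget holds uniformly in `t ∈ [0,T₀)` (from the landed `Birth.stub_slabProduction` at
`t₁ = T₀` and `slowClassBudget_of_integrableOn`): the crux is an assertion about `t ↑ T` only.
[cite: Tao2011, Cor. 11.1 + Cor. 4.3 + Thm. 5.4 (iv)] -/
theorem slowClassBudget_below {ν T T₀ : ℝ} (hν : 0 < ν) (hT₀ : 0 < T₀) (hT₀T : T₀ < T)
    {u : ℝ → EuclideanSpace ℝ (Fin 3) → EuclideanSpace ℝ (Fin 3)}
    {p : ℝ → EuclideanSpace ℝ (Fin 3) → ℝ}
    (hcl : Literature.Analysis.FluidPDE.IsClassicalNSSolutionOn (Set.Ico 0 T) ν 0 u p)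
    (hLH : Literature.Analysis.FluidPDE.IsLerayHopfOn T ν 0 (u 0) u)
    (hdec : Literature.Analysis.FluidPDE.HasRapidSpatialDecay (u 0)) (l : ℝ) :
    ∃ C : ℝ, ∀ t ∈ Set.Ico 0 T₀,
      MeasureTheory.IntegrableOn
        (fun z : ℝ × EuclideanSpace ℝ (Fin 3) =>
          inner ℝ (Literature.Analysis.FluidPDE.curl (u z.1) z.2)
            (fderiv ℝ (u z.1) z.2 (Literature.Analysis.FluidPDE.curl (u z.1) z.2)))
        {z : ℝ × EuclideanSpace ℝ (Fin 3) | z.1 ∈ Set.Ioo 0 t ∧ ‖u z.1 z.2‖ ≤ l} ∧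
      ∫ z in {z : ℝ × EuclideanSpace ℝ (Fin 3) | z.1 ∈ Set.Ioo 0 t ∧ ‖u z.1 z.2‖ ≤ l},
        inner ℝ (Literature.Analysis.FluidPDE.curl (u z.1) z.2)
          (fderiv ℝ (u z.1) z.2 (Literature.Analysis.FluidPDE.curl (u z.1) z.2)) ≤ C :=
  slowClassBudget_of_integrableOn l
    (Birth.stub_slabProduction ν T hν (hT₀.trans hT₀T) u p hcl hLH hdec T₀ hT₀ hT₀T)

/-! ## Blow-up criterion form and the reduction of the crux to maximal solutions -/

/-- **Blow-up criterion shape of the crux.**  Under the hypotheses of `SlowClassProduction`, if at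
some level `l` the slow-class budget FAILS (no `C` bounds `∫_{S_t} P` for all `t < T`), then `(u,p)`
is a maximal smooth solution with lifespan `T` (`IsMaximalSmoothSolution ν 0 u p T`: classical on
`[0,T)` and no smooth extension past `T`) — contrapositive of
`slowClassBudget_of_hasSmoothExtensionPast`. [cite: BealeKatoMajda1984, §1] -/
theorem isMaximalSmoothSolution_of_unbounded_slowClassBudget {ν T : ℝ} (hν : 0 < ν) (hT : 0 < T)
    {u : ℝ → EuclideanSpace ℝ (Fin 3) → EuclideanSpace ℝ (Fin 3)}
    {p : ℝ → EuclideanSpace ℝ (Fin 3) → ℝ}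
    (hcl : Literature.Analysis.FluidPDE.IsClassicalNSSolutionOn (Set.Ico 0 T) ν 0 u p)
    (hLH : Literature.Analysis.FluidPDE.IsLerayHopfOn T ν 0 (u 0) u)
    (hdec : Literature.Analysis.FluidPDE.HasRapidSpatialDecay (u 0)) {l : ℝ} (hl : 0 < l)
    (h : ¬ ∃ C : ℝ, ∀ t ∈ Set.Ico 0 T,
      MeasureTheory.IntegrableOn
        (fun z : ℝ × EuclideanSpace ℝ (Fin 3) =>
          inner ℝ (Literature.Analysis.FluidPDE.curl (u z.1) z.2)
            (fderiv ℝ (u z.1) z.2 (Literature.Analysis.FluidPDE.curl (u z.1) z.2)))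
        {z : ℝ × EuclideanSpace ℝ (Fin 3) | z.1 ∈ Set.Ioo 0 t ∧ ‖u z.1 z.2‖ ≤ l} ∧
      ∫ z in {z : ℝ × EuclideanSpace ℝ (Fin 3) | z.1 ∈ Set.Ioo 0 t ∧ ‖u z.1 z.2‖ ≤ l},
        inner ℝ (Literature.Analysis.FluidPDE.curl (u z.1) z.2)
          (fderiv ℝ (u z.1) z.2 (Literature.Analysis.FluidPDE.curl (u z.1) z.2)) ≤ C) :
    Literature.Analysis.FluidPDE.IsMaximalSmoothSolution ν 0 u p T :=
  ⟨hcl, fun hext => h (slowClassBudget_of_hasSmoothExtensionPast hν hT hLH hdec hext l hl)⟩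

/-- **`SlowClassProduction` is equivalent to its restriction to maximal smooth solutions.**  The
crux (stated for every classical Leray–Hopf solution on every `[0,T)`) holds iff it holds for the
solutions that do NOT extend smoothly past `T` (`IsMaximalSmoothSolution ν 0 u p T`, i.e. `T` is the
lifespan): for the others `slowClassBudget_of_hasSmoothExtensionPast` gives the budget.  So the
content of the crux is exactly an a-priori bound at a first blow-up time (the COLLAR stub of the
registered skeleton `Lines/birth.lean`); in particular it follows from, and does not cheaply give,
`NavierStokesRegularity`. [cite: BealeKatoMajda1984, §1] -/
theorem slowClassProduction_iff_maximal :
    Summit.NavierStokesRegularity.NavierStokesRegularity.Theses.HodographBetchov.SlowClassProduction ↔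
    ∀ (ν T : ℝ), 0 < ν → 0 < T →
      ∀ (u : ℝ → EuclideanSpace ℝ (Fin 3) → EuclideanSpace ℝ (Fin 3))
        (p : ℝ → EuclideanSpace ℝ (Fin 3) → ℝ),
        Literature.Analysis.FluidPDE.IsMaximalSmoothSolution ν 0 u p T →
        Literature.Analysis.FluidPDE.IsLerayHopfOn T ν 0 (u 0) u →
        Literature.Analysis.FluidPDE.HasRapidSpatialDecay (u 0) →
        ∀ l : ℝ, 0 < l → ∃ C : ℝ, ∀ t ∈ Set.Ico 0 T,
          MeasureTheory.IntegrableOn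
            (fun z : ℝ × EuclideanSpace ℝ (Fin 3) =>
              inner ℝ (Literature.Analysis.FluidPDE.curl (u z.1) z.2)
                (fderiv ℝ (u z.1) z.2 (Literature.Analysis.FluidPDE.curl (u z.1) z.2)))
            {z : ℝ × EuclideanSpace ℝ (Fin 3) | z.1 ∈ Set.Ioo 0 t ∧ ‖u z.1 z.2‖ ≤ l} ∧
          ∫ z in {z : ℝ × EuclideanSpace ℝ (Fin 3) | z.1 ∈ Set.Ioo 0 t ∧ ‖u z.1 z.2‖ ≤ l},
            inner ℝ (Literature.Analysis.FluidPDE.curl (u z.1) z.2)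
              (fderiv ℝ (u z.1) z.2 (Literature.Analysis.FluidPDE.curl (u z.1) z.2)) ≤ C := by
  unfold _root_.Summit.NavierStokesRegularity.NavierStokesRegularity.Theses.HodographBetchov.SlowClassProduction
  constructor
  · intro h ν T hν hT u p hmax hLH hdec l hl
    exact h ν T hν hT u p hmax.1 hLH hdec l hl
  · intro h ν T hν hT u p hcl hLH hdec l hl
    by_cases hext : Literature.Analysis.FluidPDE.HasSmoothExtensionPast ν 0 u T
    · exact slowClassBudget_of_hasSmoothExtensionPast hν hT hLH hdec hext l hl
    · exact h ν T hν hT u p ⟨hcl, hext⟩ hLH hdec l hl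

end Summit.NavierStokesRegularity.NavierStokesRegularity.Theorems.SlowClassProduction

end
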